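import Mathlib
import HarnessLib
import HarnessLib.Audit
import Summits.HodgeConjecture.HodgeConjecture.Statement
import Literature.AlgebraicGeometry.HodgeTheory.AbsoluteHodgeClasses
import Literature.AlgebraicGeometry.HodgeTheory.GysinFormalism
import Literature.AlgebraicGeometry.Motives.FamiliesVHS
import Literature.AlgebraicGeometry.Motives.BaseChange

/-!
Route: MilnorFluxCusps

CLOSED (retired) 2026-08-15T13:48:16Z by operator:999:1257524 — reason: not-a-thesis: assembly does not conclude the sub-problem Statement — note: D-0027 §2.1 audit (human 2026-08-15: routes that do not decide the summit are removed): the assembly concludes `CuspAccessibleHodge`, not the sub-problem statement; a NEW conforming route may be opened from the same idea (generated `closes : … → _root_.HodgeConjecture`).. The file is kept as the record of this route; refuted decls are indexed as negative knowledge (`ledger negatives`).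

# Route MilnorFluxCusps — Hodge theory has no Ext², motives do: at a ℚ̄-Tate cusp the limit of an
absolute Hodge class is a K-class for free (Ext² of mixed Tate motives over a number field vanishes,
Borel); deform it sideways

It suffices to show X = CuspAccessibleHodge (realises card ext2-milnor-flux-arithmetic-cusps,
proving direction: its theorem-candidate (G) + its hand-over step E4, typed on the tree's real
carriers): THE HODGE CONJECTURE HOLDS FOR CUSP-ACCESSIBLE ABSOLUTE HODGE CLASSES. Data: a smooth
projective 𝒳/ℂ of dimension N, a smooth projective curve C, a morphism f : 𝒳 → C and a point o ∈
C(ℂ) whose scheme-theoretic fibre X_o = f⁻¹(o) is ℚ̄-TATE — isomorphic over ℂ to the base change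
along some σ : ℚ̄ → ℂ of a ℚ̄-scheme admitting a finite partition into locally closed split tori
𝔾_m^b (affine pavings qualify since 𝔸^a is stratified by tori; so do snc unions of toric varieties
glued along torus-invariant strata, e.g. the fibre at a 0-dimensional toroidal cusp of a
Shimura-type Hodge locus). Claim: for every ABSOLUTE HODGE class ξ ∈ H^(2p)(𝒳(ℂ);ℂ) and every smooth
projective fibre X_t, the restriction ξ|X_t is algebraic (lies in algebraicClasses X_t p). In words:
a flat family of Hodge classes over a curve of its Hodge locus that reaches a ℚ̄-Tate cusp and
extends to an absolute Hodge class on the semistable total space (automatic for motivated classes by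
André's deformation principle, hence for all Hodge classes on abelian varieties) consists of
algebraic classes. X = K1 then K2: K1 = ArithmeticTateRestriction (ξ|X_o is a Chern character of
K₀(X_o)⊗ℚ, rendered as membership in the span PB^p(X_o) of pulled-back algebraic classes — the
card's (G)), K2 = KClassPropagates (a K-theoretic limit propagates to the smooth fibres — the card's
E4); Assembly = K1 → K2 → X is proved in the planner's Sketch.lean.
Lean: `∀ (N p : ℕ) (𝒳 C : Literature.AlgebraicGeometry.Motives.SchemeOver ℂ) (f : 𝒳 ⟶ C) (o :
Literature.AlgebraicGeometry.Motives.AlgPoints C ℂ),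
Literature.AlgebraicGeometry.Motives.IsSmoothProjective N 𝒳 →
Literature.AlgebraicGeometry.Motives.IsSmoothProjective 1 C → (∃ (X₁ :
Literature.AlgebraicGeometry.Motives.SchemeOver (AlgebraicClosure ℚ)) (σ : AlgebraicClosure ℚ →+* ℂ)
(_ : Literature.AlgebraicGeometry.Motives.fiberOver f o ≅
(Literature.AlgebraicGeometry.Motives.baseChangeHom σ).obj X₁) (ι : Type) (_ : Finite ι) (b : ι → ℕ)
(e : ∀ i : ι, Literature.AlgebraicGeometry.Motives.specOver (AlgebraicClosure ℚ) (AddMonoidAlgebra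
(AlgebraicClosure ℚ) (Fin (b i) →₀ ℤ)) ⟶ X₁), (∀ i, AlgebraicGeometry.IsImmersion (e i).left) ∧
(Pairwise fun i j => Disjoint (Set.range fun x => (e i).left.base x) (Set.range fun x => (e
j).left.base x)) ∧ (⋃ i, Set.range fun x => (e i).left.base x) = Set.univ) → ∀ ξ :
Literature.AlgebraicGeometry.HodgeTheory.complexBetti 𝒳 (2 * p),
Literature.AlgebraicGeometry.HodgeTheory.IsAbsoluteHodgeClass N 𝒳 p ξ → ∀ (t :
Literature.AlgebraicGeometry.Motives.AlgPoints C ℂ) (n : ℕ),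
Literature.AlgebraicGeometry.Motives.IsSmoothProjective n
(Literature.AlgebraicGeometry.Motives.fiberOver f t) →
(Literature.AlgebraicGeometry.HodgeTheory.complexBetti.map
(Literature.AlgebraicGeometry.Motives.fiberι f t) (2 * p)).hom ξ ∈
Literature.AlgebraicGeometry.HodgeTheory.algebraicClasses
(Literature.AlgebraicGeometry.Motives.fiberOver f t) p`

## Assembly
Pure logic, sorry-free in Sketch.lean (`assembly_holds`, axioms propext / Classical.choice /
Quot.sound): fix the data of X; an absolute Hodge class is rational and of type (p,p)
(IsAbsoluteHodgeClass.isRationalClass / .isOfHodgeType); ArithmeticTateRestriction puts ξ|X_o into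
PB^p(X_o); KClassPropagates turns that into algebraicity on every smooth projective fibre. The Weil
application is the informal crux HyperbolicWeilCusps filed right after open: for every abelian
2n-fold of Weil type on a HYPERBOLIC component (disc H = (−1)^n mod Nm K*, equivalently a
0-dimensional toroidal cusp exists) and every Weil class w it supplies a datum of X — a ℚ̄-curve
through a 0-dimensional cusp of the Weil locus, its semistable projective model 𝒳 → C with
torus-partitioned snc fibre (Mumford / FaltingsChai1990), and a motivated (hence absolute Hodge)
extension ξ of the Weil plane with ξ|X_t₁ = w (Andre1996Motifs Thm 0.5 + Deligne1982HodgeCycles) —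
so X ⟹ Weil classes algebraic on hyperbolic components for all n ≥ 2 (open for n ≥ 4), the sector of
WeilConeBoundary.Target and the hyperbolic half of TropicalCuspLift.WeilClassesAlgebraic. The summit
frame X → HodgeConjecture is the complement of the scope (implied by HodgeConjecture itself) and is
deliberately NOT filed: the route is PARTIAL by design, as WeilConeBoundary.

Rationale: WHY THIS LINE. Mixed Hodge structures have no Ext², motives over ℂ do, and the card reads the
obstruction to a LIMIT Hodge class being motivic on the snc fibre X₀ = ∪X_i of a semistable
degeneration off the closed-cover/cdh descent spectral sequence E₁^(a,b) = CH^p(X^[a], 2p−b)_ℚ ⇒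
H^(2p)_M(X₀, ℚ(p)): Bloch's exotic class (Bloch1990LetterJannsen; Arapura2016SingularLefschetz Ex.
8.2) is the d₁/Abel–Jacobi-kernel species, behind it sit the regulator-invisible species d₂ ∈ K₁ and
d₃ ∈ K₂(ℂ) ⊗ H³(dual complex) ('Milnor flux': Steinberg symbols of the gluing parameters,
Milnor1972) and d₄ ∈ K₃^ind(ℂ) ⊗ H⁴(Γ). Where X₀ together with its Tate stratification is defined
over a number field F all of it dies: M(X₀) ∈ DMT(F) carries Levine's motivic t-structure,
Ext²_MT(F) = 0 and Ext¹_MT(F)(ℚ(0), ℚ(j)) = K_(2j−1)(F)_ℚ with K_(2j−2)(F) ⊗ ℚ = 0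
(DeligneGoncharov2005 §§1–2, Borel1977), so H^(2p)_M(X₀, ℚ(p)) ↠ Hom_MT(ℚ(−p), h^(2p)(X₀)) and the
one remaining Ext¹ lift-obstruction is detected by the Hodge realisation at ALL complex places
(Borel's regulator injectivity; units inject at a single place) — exactly what an ABSOLUTE Hodge
class on the total space supplies (Deligne1982HodgeCycles for abelian varieties; Andre1996Motifs Thm
0.5 extends a motivated flat section to a motivated class on the compactified family). Hence at
arithmetic cusps the anchor every cusp programme needs — a K-class on the toric fibre whose Chern
character is the limit Hodge class (the input of TropicalCuspLift's DepthOneLogLift;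
Kontsevich–Zharkov's tropical test Zharkov2020TropicalWeil run in reverse) — is FREE and
unconditional (Arapura's Conj. 8.1, conditional on HC + Bloch–Beilinson and depth ≤ 2 in
Arapura2016SingularLefschetz Prop. 8.3, becomes a short argument for mixed Tate X₀), and the whole
difficulty is concentrated in ONE sideways step: deform the K₀(X₀)-class off the snc fibre along the
Hodge locus and algebraize (log form of BlochEsnaultKerz2014CharZero; FaltingsChai1990 for the
toroidal models). Imported areas: mixed Tate motives and K-theory of number fields
(DeligneGoncharov2005, Borel1977, Milnor1972), cdh-descent / homotopy K-theory of singular varieties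
(Arapura2016SingularLefschetz §§6–8, Totaro2014ChowLinear §8, Anderson–Payne arXiv:1301.0425),
toroidal degenerations of abelian varieties (FaltingsChai1990), absolute Hodge and motivated classes
(Deligne1982HodgeCycles, Andre1996Motifs, CharlesSchnell2014Notes). Two rendering devices make it
typable on real carriers (the tree has no algebraic K-theory and no mixed Hodge structures):
'ch_p-image of K₀(X₀) ⊗ ℚ' = PB^p(X₀), the ℂ-span of pull-backs g^*a of algebraic classes a along
all morphisms g : X₀ → Y to smooth projective Y (equal to it by Grassmannians +
Grothendieck–Riemann–Roch; Arapura Lemma 8.6 is one inclusion into im H_M), and 'weight-2p Hodge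
cycle on X₀' = restriction of a Hodge class of the smooth projective total space (image of a pure
weight-2p structure, so a genuine Hom_MHS(ℚ(−p), H^(2p)(X₀)) element — never one of the
W_(2p−1)-phantoms that the barrier file's IsHodgeOnSmoothPullbacks admits). What prior routes do not
do: TropicalCuspLift lifts semiregular OBJECTS through depth-1 cusps by induction from Markman's
fourfolds and must BUILD its cycle on the toric fibre (tropical HC); QbarEnvelope and
AnchorTransport anchor at interior ℚ̄-points (KOU, André); LimitExtension and SecondaryPeriods never
leave (limit) mixed Hodge theory = Ext¹; none uses the K-theory of the degenerate fibre or the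
vanishing of Ext² over number fields.

RANKED CRUXES. #0 CuspAccessibleHodge (target) — X as in the Thesis: smooth projective 𝒳 → C over a
smooth projective curve, o ∈ C(ℂ) with ℚ̄-Tate fibre X_o (base change of a ℚ̄-scheme partitioned
into finitely many locally closed split tori), ξ ∈ H^(2p)(𝒳(ℂ);ℂ) absolute Hodge ⟹ ξ|X_t ∈
algebraicClasses X_t p for every smooth projective fibre X_t. (why it might fail: Implied by HC
(HC-safe). Non-vacuous only where ℚ̄-Tate cusps exist: for Weil type exactly the HYPERBOLIC
components (disc = (-1)^n mod Nm K*), so the n = 3 non-hyperbolic frontier is not served; first open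
cases n >= 4; needs absolute Hodge extension on the total space.) [Arapura2016SingularLefschetz,
DeligneGoncharov2005, FaltingsChai1990, Andre1996Motifs, Markman2025SecantWeil,
vanGeemen1994HodgeAV]
#2 ArithmeticTateRestriction (crux) — (card (G)/(M3) and E0 — the arithmetic-cusp theorem-candidate,
typed.) For 𝒳, C, f, o as in X with X_o ℚ̄-Tate and ξ ∈ H^(2p)(𝒳(ℂ);ℂ) absolute Hodge, ξ|X_o lies in
PB^p(X_o) := ℂ-span of {g^*a : g : X_o → Y a ℂ-morphism, Y smooth projective, a ∈ algebraicClasses Y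
p} ( = ch_p(K₀(X_o) ⊗ ℚ) ⊗ ℂ: every vector bundle is a Grassmannian pull-back after an ample twist,
and conversely g^*cl(Z) = ch_p(g^*u) with u = ch⁻¹[Z] ∈ K₀(Y)_ℚ by GRR, ch(u) concentrated in degree
p; a rational class in the ℂ-span of rational vectors lies in their ℚ-span). Intended proof: ξ|X_o ∈
Hom_MHS(ℚ(−p), H^(2p)(X_o)) (image of a pure weight-2p structure); X_o ≅ X₁ ⊗_σ ℂ with X₁
torus-partitioned over ℚ̄, hence over a number field F, so M(X₁) ∈ DMT(F); Ext²_MT(F) = 0 gives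
H^(2p)_M(X₁, ℚ(p)) ↠ Hom_MT(F)(ℚ(−p), h^(2p)(X₁)); Gr^W_(2p)(ξ|X_o) is a ℚ-combination of cycle
classes of strata, canonically defined over F, and the Ext¹_MT-obstruction to lifting it into W_(2p)
has vanishing Hodge realisation at EVERY complex place τ = σ'σ because the conjugate ξ^σ' is again a
Hodge class restricting to X_o^σ' (absolute Hodge) — Borel injectivity on ⊕_τ for K_(2j−1)(F)_ℚ, j ≥
2, units at j = 1, dévissage along the weight filtration — so a motivic lift exists; by strictness
its realisation IS ξ|X_o; finally H^(2p)_M = KH₀(X_o)^(p)_ℚ (cdh descent) and the class must be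
reached from honest K₀(X_o) ⊗ ℚ (the K₀-vs-KH₀ step, see why it might fail). General form (not
typed): the same for g^*ξ along any morphism g from a quasi-projective ℚ̄-Tate X₀. [difficulty: XL]
(why it might fail: (G) lands in cdh-motivic H^{2p}_M = KH_0^{(p)}; the typed conclusion is honest
K_0 (PB = Chern characters of vector bundles). K_0 -> KH_0 can miss Hodge cycles (BVS cuspidal
surface, p = 1: in H^2_M, not in Pic); for snc unions of toric varieties K_0-regularity in Adams
degree p is unproved.) [Arapura2016SingularLefschetz, DeligneGoncharov2005, Borel1977,
Bloch1990LetterJannsen, Deligne1982HodgeCycles, Totaro2014ChowLinear, arXiv:1301.0425,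
arXiv:1907.00076]
#3 KClassPropagates (crux) — (card E4, the sideways step; ANY fibre, no arithmetic.) For f : 𝒳 → C
as above and ξ ∈ H^(2p)(𝒳(ℂ);ℂ) rational of Hodge type (p,p): if ξ|X_o ∈ PB^p(X_o) — i.e. ξ|X_o =
ch_p(v) for some v ∈ K₀(X_o) ⊗ ℚ with ch(v) concentrated in degree p — then ξ|X_t is algebraic on
every smooth projective fibre X_t. Mechanism: represent v by perfect complexes on X_o, deform over
the formal/log germ of C at o (log Bloch–Esnault–Kerz: the obstruction is the Hodge obstruction,
which vanishes because ξ is globally of type (p,p)), algebraize (𝒳 is projective over C), read off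
ch_p = ξ|X_t for t near o, spread along C (countably many relative Chow components, one dominates).
Contains Grothendieck's variational Hodge conjecture over curves (support VariationalHodgeOverCurves
= the case X_o smooth; KClassPropagates → it is proved in Sketch.lean). [deps:
ArithmeticTateRestriction] [difficulty: open-problem] (why it might fail: Contains Grothendieck's
variational HC (X_o smooth). Mechanism: log-BEK formal lifting of perfect complexes on an snc fibre
is unproved; algebraization of formal K-classes fails in general (BEK); a K_0-class without
semiregular representative may be obstructed. Typed form fails only with HC.)
[BlochEsnaultKerz2014CharZero, Bloch1972Semiregularity, BuchweitzFlenner2003, arXiv:2604.00511,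
Steenbrink1976]
#9 VariationalHodgeOverCurves (support) — the smooth-special-fibre case of KClassPropagates =
Grothendieck's variational Hodge conjecture in global-class form over a projective curve: ξ rational
of type (p,p) on a smooth projective 𝒳 → C, ξ|X_o algebraic on ONE smooth projective fibre X_o ⟹
ξ|X_t algebraic on every smooth projective fibre. Filed to make the containment explicit
(KClassPropagates → VariationalHodgeOverCurves, three lines in Sketch.lean: an algebraic class on a
smooth projective fibre is a pulled-back algebraic class along the identity) and as the meeting
point with route AnchorTransport's VariationalHodge (smooth families over an arbitrary smooth base,
total space not compactified). Open problem in general (known for p = 1 and in BEK's formal form).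
[difficulty: open-problem] [BlochEsnaultKerz2014CharZero, Bloch1972Semiregularity]

TWO-LAYER PLAN. Foreseen glued splits (k ≤ 3, depth 1), none filed now because the tree lacks
K-theory and log structures: KClassPropagates ⇐ LogFormalKLift (pro-class on the formal completion
of 𝒳 along X_o, log-BEK) → KAlgebraization (formal K-class ⟹ K-class over the henselised curve) →
KClassPropagates (spreading glue); ArithmeticTateRestriction ⇐ MotivicLift (ξ|X_o ∈ im H^(2p)_M, the
pure (G)) → SncToricKRegularity (K₀ ⊗ ℚ → KH₀ ⊗ ℚ onto Adams degree p for snc unions of smooth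
projective toric varieties) → ArithmeticTateRestriction; HyperbolicWeilCusps ⇐ CuspModel (relatively
complete model over a ℚ̄-curve, smooth cone decomposition) → MotivatedExtension (André Thm 0.5 +
Deligne) → HyperbolicWeilCusps.

KILL CRITERIA. (i) The typed items are HC-safe: refuting CuspAccessibleHodge,
ArithmeticTateRestriction or KClassPropagates as typed exhibits a counterexample to HC (route and
summit settle together; the negated decl is the certificate). Mechanism kills: (ii) a proof that
K₀(X_o) ⊗ ℚ → KH₀(X_o) ⊗ ℚ is NOT onto Adams degree p for the Mumford cusp fibres (snc unions of
smooth projective toric varieties) kills the proof (G) of K1 — pivot: restate K1 for a semistable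
model after base change / perfect complexes, else close; (iii) a gap in 'absolute Hodge ⟹ Hodge
lifts at all places ⟹ Borel' (e.g. the Gr^W_(2p) component not canonically F-rational) sends K1 back
to single-place regulator injectivity, which is open — close unless W_(2p−4)H^(2p)(X_o) = 0 in the
application (then only units occur and one place suffices: restate with that hypothesis); (iv) the
informal negative-side item MilnorFluxInhabited REFUTED (d₃, d₄ vanish on limits of Hodge classes
over ℂ) is not a kill but an upgrade: drop ℚ̄ from K1 (route edit --restate); (v) an obstructed
example for log-deformation of K-classes without semiregular representatives at an snc fibre inside
a Hodge locus kills K2's mechanism → close --reason superseded --by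
route-HodgeConjecture-TropicalCuspLift (semiregular objects); (vi) TropicalCuspLift.WittTowerStep or
WeilConeBoundary.Target proved ⟹ the Weil application is moot; X survives only as a general engine
for other cusp-accessible loci.

NOT DECOMPOSED YET. Filed INFORMAL right after open (signatures later): HyperbolicWeilCusps (crux,
rank 4; typing needs a hyperbolicity predicate bridging H¹(A(ℂ),ℚ) to Motives.WeilDiscriminant —
definition request), the negative side of the card — FluxWellDefined (support = E1: the flux of a
limit Hodge cycle is model-independent modulo the stated indeterminacy), MilnorFluxInhabited (crux,
rank 5 = E2: an snc ℂ-variety with toric strata and a limit Hodge cycle of nonzero K₂-flux; its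
refutation upgrades K1 to ℂ), SteinbergSymbolMatrix (support = E3: the symbol matrix of Zharkov's
tropical Weil classes at a 2-parameter cusp, kit-sized) — and SncToricKRegularity (support).
Deliberately not decomposed: non-hyperbolic Weil components (positive-dimensional cusps with CM
abelian parts: (G) there needs Beilinson's conjectures for the abelian part — conditional, a
separate conditional bridge if ever); the log-BEK / algebraization split of K2 and the K₀-vs-KH₀
split of K1 (Two-layer plan); spreading from 'all fibres of one curve' to 'the whole Hodge-locus
component' (Baire/CDK; TropicalCuspLift.BaireSpreading) — not needed for X as typed.

CHEAPEST FALSIFIER. Both on the MECHANISM of K1 (the typed items cannot fail unless HC fails). (a)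
Lookup: Anderson–Payne (arXiv:1301.0425 §1) ask whether K⁰(X) → opK⁰(X) is onto for complete toric
X; the K₀-form of (G) asserts its rational cohomological shadow for every projective toric X/ℚ (each
weight-2p Hodge cycle of H^(2p)(X,ℚ) is a K₀ Chern character) (cf. arXiv:1907.00076, Gubeladze): one
projective toric threefold with a weight-4 Hodge cycle outside ch₂(K₀ ⊗ ℚ) kills the K₀-form of (G)
for toric (non-snc) fibres and throws K1 onto the snc/K-regularity bet. (b) Finite computation (the
card's calibration): at a ℚ̄ totally degenerate cusp of Weil-type abelian FOURFOLDS (p = 2, Γ = real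
4-torus, H³(Γ) = ℚ⁴, H⁴(Γ) = ℚ) run the closed-cover descent spectral sequence for the Mumford fibre
(smooth projective toric components, K_*(X_I) = K_*(ℚ̄) ⊗ K₀(X_I)) and decide whether K₀ ⊗ ℚ → KH₀ ⊗
ℚ is onto Adams degree 2; Markman's theorem + semistable reduction force the limit Weil classes into
ch₂(K₀ ⊗ ℚ) of SOME model, so failure on the minimal model isolates what (G) cannot deliver. lit
search unavailable (rc 75) all session: (a) NOT done — refuters first.

NUMBERS. Weil type (A, K = ℚ(√−d), h), dim A = 2n, signature (n,n), Weil plane of dimension 2;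
hyperbolic ⟺ disc H = (−1)^n in ℚ*/Nm(K*) ⟺ Witt index n ⟺ a 0-dimensional (totally degenerate,
torus rank 2n) cusp exists (vanGeemen1994HodgeAV 5.2–5.4; Markman2025SecantWeil §1.1;
TropicalCuspLift planner's dictionary); known: n = 2 all discriminants (Markman2025SecantWeil,
arXiv:2509.23079), n = 3 disc −1 = hyperbolic (arXiv:2502.03415); open: n = 3 non-hyperbolic, every
n ≥ 4. K-theory of a number field F with r₁ real and r₂ complex places: K_(2j−2)(F) ⊗ ℚ = 0 for j ≥
2, rank K_(2j−1)(F) = r₂ (j even), r₁ + r₂ (j odd ≥ 3), ⊕_places regulator injective ⊗ ℚ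
(Borel1977); K₁(F) = F* (infinite rank, injective into ℂ* at one place). Mixed Tate motives over F:
Ext^i_MT(F) = 0 for i ≥ 2, Ext¹(ℚ(0),ℚ(j)) = K_(2j−1)(F)_ℚ (DeligneGoncharov2005 §§1–2). At a
totally degenerate cusp of abelian 2n-folds: dual complex Γ ≃ (S¹)^(2n); for p = 2: H³(Γ) =
ℚ^C(2n,3) (K₂-flux species), H⁴(Γ) = ℚ^C(2n,4) (K₃^ind species).

DEFINITION REQUESTS. - HasSplitTorusPartition (Literature/AlgebraicGeometry/Motives): a k-scheme
admits a finite partition into locally closed subschemes isomorphic over k to split tori Spec k[ℤ^b]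
(inlined verbatim in K1 and the Target), with the facts 'affinely paved ⟹ torus-partitioned' and
'M(X) mixed Tate'.
- pulledBackAlgebraicClasses X p (Literature/AlgebraicGeometry/HodgeTheory): the ℂ-submodule PB^p(X)
of complexBetti X (2p) spanned by pull-backs of algebraicClasses Y p along morphisms X → Y, Y smooth
projective (inlined in K1, K2), with PB^p(X) = algebraicClasses X p for smooth projective X
(provable now: identity map one way, pull-back of supported classes the other) and the informal
dictionary PB = ch_p(K₀ ⊗ ℚ) ⊗ ℂ for quasi-projective X.
- IsHyperbolicWeilType (bridge Motives.AbelianVariety / HodgeTheory.WeilClasses.weilClassesOf ↔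
Motives.WeilDiscriminant through the polarisation form on H¹(A(ℂ),ℚ)): needed to give
HyperbolicWeilCusps a signature.
- cite facts wanted (family hodge): Ext^(≥2)_MT(F) = 0 and Ext¹ = K_(2j−1)(F)_ℚ for number fields
(DeligneGoncharov2005); Borel's regulator injectivity (Borel1977); André's deformation principle for
motivated classes and 'Hodge ⟹ motivated on abelian varieties' (Andre1996Motifs Thm 0.5, 0.6.2;
barrier decl Andre1996_hodgeClassesOnAbelianVarieties_motivated exists); Arapura's cycle map
H^(2p)_M → weight-2p Hodge cycles, Lemma 8.6 and Conj. 8.1 (Arapura2016SingularLefschetz); Deligne's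
'Hodge classes on abelian varieties are absolute' (HodgeClassesAreAbsoluteFor, already in the
barrier file).

Novelty: Searches (2026-08-15, this session): `lean search` for
Milnor|Steinberg|KTheory|K₀|MixedHodge|dualComplex|cdh|toric|cellular|paving (tree: no algebraic
K-theory, no MHS of singular varieties, no toric varieties; snc divisors exist in Resolution/),
`ledger idea list --problem HodgeConjecture` (115 cards; related and read:
tropical-cusp-log-semiregular-lift [route TropicalCuspLift], qbar-anchors-kou-andre-motivated
[QbarEnvelope], continuous-k-theory-algebraization, padic-semiregular-object-lifting
[PadicSemiregularLift], milnor-k-gerbe-exponential, liaison-limit-extension-ci-universality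
[LimitExtension], secondary-periods-beilinson-bloch-test [SecondaryPeriods],
motivated-anchor-transport [AnchorTransport]), route files TropicalCuspLift, WeilConeBoundary,
QbarEnvelope, LimitExtension, AnchorTransport, PeriodsPolice, FiniteTreeOfFlavours,
DegreeSpectroscopy read; `ledger negatives --problem HodgeConjecture` (0); `lit read
arXiv:1605.00587` pp. 17–18 (Conj. 8.1, Ex. 8.2, Prop. 8.3, Lemmas 8.4–8.7, Cor. 8.5/8.8/8.11
verbatim); `lit search` ('operational K-theory toric varieties Anderson Payne Kronecker duality
surjective'; 'K-regularity cdh-fibrant Hochschild homology normal crossing KH', --source local)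
attempted 3× — searchd unavailable (rc 75) all session, so the card's six documented
lit/zbMATH/galaxy queries (2026-08-15) and its novelty audit u18 (new-combination; nearest prior
named and read: Arapura pp. 1, 17–18; Bloch's letter LNM 1400 pp. 187–188) are relied upon and no  [refs: 1605.00587, 1301.0425, DeligneGoncharov2005]

Barriers (technique_class: motivic-ext2-flux, arithmetic-cusps, cdh-k-theory): - technique_class: motivic-ext2-flux, arithmetic-cusps, cdh-k-theory
-
Literature.Barriers.HodgeConjecture.Bloch1990_cohomologicalHodgeConjecture_singular_counterexample:
not evaded — USED as the map of the obstruction. K1 asserts the K-theoretic singular Hodge statement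
only for (a) restrictions of ambient absolute Hodge classes (genuine weight-2p Hodge cycles, never
the W_(2p−1)-phantoms that IsHodgeOnSmoothPullbacks admits, and implied by HC through PB ∋
restrictions of ambient algebraic classes) on (b) ℚ̄-mixed-Tate X₀, where Bloch's witness cannot
live (it needs a ℚ̄-generic point and h²_tr(S) ≠ 0, i.e. Ext² of a non-Tate motive over ℂ);
KTheoreticHodgeConjectureDegreeFour B C X for general X is never claimed.
-
Literature.Barriers.HodgeConjecture.BarbieriVialeSrinivas1994_singularLefschetzOneOne_counterexample:
it sharpens K1's why-might-fail rather than blocking it: Y is ℚ̄-definable and cdh-Tate, its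
weight-2 Hodge cycles lie in H²_M (Arapura Thm 7.8) but not in c₁(K₀) — the K₀-vs-KH₀ gap is real
for cuspidal (non-snc, 𝔾_a-type) singularities; evaded in the typed K1 because restricted ambient
classes are c₁ of restricted line bundles (Lefschetz (1,1) on 𝒳), and in the mechanism by the bet
that snc unions of smooth toric varieties (seminormal, multiplicative gluing only) are K-regular
enough in Adams degree p.
- Literature.Barriers.HodgeConjecture.Grothendieck1969_generalHodgeConjecture_false: no
coniveau/level statement is made; the ℚ-structure is used essentially (ℚ-

Novelty grade: new-combination — ROUTE REVIEW (refuter rreview 935e0e2b, 2026-08-15T14Z; route already retired 13:48Z under D-0027 §2.1). For any conforming re-open from card ext2-milnor-flux-arithmetic-cusps: KClassPropagates (stmt-7588) and CuspAccessibleHodge (stmt-7586) are INFLATED as typed — machine-checked evidence Inflation (refuter refuter-rreview-route-SmoothPoincare4-Le-935e0e2b-0, 2026-08-15T14:04:52Z; prior: arXiv:1605.00587,arXiv:1301.0425,DeligneGoncharov2005)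

History (route lifecycle, newest last):
- 2026-08-15T13:48:16Z · CLOSED retired — not-a-thesis: assembly does not conclude the sub-problem Statement (operator:999:1257524)

sub-problem: HodgeConjecture · status: closed(retired) · opened planner-plancard-HodgeConjecture-HodgeConject-077d2bd2-0 2026-08-15T12:12:29Z · rev 1 · ledger route-HodgeConjecture-MilnorFluxCusps
GENERATED by the gate from the ledger (D-0016/17). Provers cite these decls: `theorem foo : Summit.HodgeConjecture.HodgeConjecture.Theses.MilnorFluxCusps.<Decl> := …` in Summits/HodgeConjecture/HodgeConjecture/Theorems/<Name>.lean.
-/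

namespace Summit.HodgeConjecture.HodgeConjecture.Theses.MilnorFluxCusps

open scoped BigOperators Topology Manifold Classical MeasureTheory ProbabilityTheory Matrix InnerProductSpace ComplexConjugate ContinuousMap
open Filter Set Function TopologicalSpace MeasureTheory

attribute [summit_statement] _root_.HodgeConjecture

/-- item stmt-HodgeConjecture-7586 · target · rank 0 · closed · moot by None · by planner
why it might fail: MISSTATED: constant f, o ∉ f(𝒳): X_o = ∅ is vacuously ℚ̄-Tate, X_{f(𝒳)} ≅ 𝒳, so X says every absolute Hodge class on every smooth projective variety is algebraic = Charles–Schnell Conj. 11.2.18 (⟹ std. conj. B, C; HC for ab. var.); needs X_o ≠ ∅. HC-safe. Then ℚ̄-Tate cusps only (Weil: hyperbolic).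
sources: CharlesSchnell2014Notes, Deligne1982HodgeCycles, Andre1996Motifs, Arapura2016SingularLefschetz, FaltingsChai1990, vanGeemen1994HodgeAV
[target] X as in the Thesis: smooth projective 𝒳 → C over a smooth projective curve, o ∈ C(ℂ) with
ℚ̄-Tate fibre X_o (base change of a ℚ̄-scheme partitioned into finitely many locally closed split
tori), ξ ∈ H^(2p)(𝒳(ℂ);ℂ) absolute Hodge ⟹ ξ|X_t ∈ algebraicClasses X_t p for every smooth
projective fibre X_t. -/
@[route_item "route-HodgeConjecture-MilnorFluxCusps"]
def CuspAccessibleHodge : Prop :=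
  ∀ (N p : ℕ) (𝒳 C : Literature.AlgebraicGeometry.Motives.SchemeOver ℂ) (f : 𝒳 ⟶ C) (o : Literature.AlgebraicGeometry.Motives.AlgPoints C ℂ), Literature.AlgebraicGeometry.Motives.IsSmoothProjective N 𝒳 → Literature.AlgebraicGeometry.Motives.IsSmoothProjective 1 C → (∃ (X₁ : Literature.AlgebraicGeometry.Motives.SchemeOver (AlgebraicClosure ℚ)) (σ : AlgebraicClosure ℚ →+* ℂ) (_ : Literature.AlgebraicGeometry.Motives.fiberOver f o ≅ (Literature.AlgebraicGeometry.Motives.baseChangeHom σ).obj X₁) (ι : Type) (_ : Finite ι) (b : ι → ℕ) (e : ∀ i : ι, Literature.AlgebraicGeometry.Motives.specOver (AlgebraicClosure ℚ) (AddMonoidAlgebra (AlgebraicClosure ℚ) (Fin (b i) →₀ ℤ)) ⟶ X₁), (∀ i, AlgebraicGeometry.IsImmersion (e i).left) ∧ (Pairwise fun i j => Disjoint (Set.range fun x => (e i).left.base x) (Set.range fun x => (e j).left.base x)) ∧ (⋃ i, Set.range fun x => (e i).left.base x) = Set.univ) → ∀ ξ : Literature.AlgebraicGeometry.HodgeTheory.complexBetti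 𝒳 (2 * p), Literature.AlgebraicGeometry.HodgeTheory.IsAbsoluteHodgeClass N 𝒳 p ξ → ∀ (t : Literature.AlgebraicGeometry.Motives.AlgPoints C ℂ) (n : ℕ), Literature.AlgebraicGeometry.Motives.IsSmoothProjective n (Literature.AlgebraicGeometry.Motives.fiberOver f t) → (Literature.AlgebraicGeometry.HodgeTheory.complexBetti.map (Literature.AlgebraicGeometry.Motives.fiberι f t) (2 * p)).hom ξ ∈ Literature.AlgebraicGeometry.HodgeTheory.algebraicClasses (Literature.AlgebraicGeometry.Motives.fiberOver f t) p

/-- item stmt-HodgeConjecture-7587 · crux · rank 2 · closed · moot by None · by planner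
why it might fail: HC-safe as typed (HC ⟹ it; X_o = ∅ or X_o ≅ 𝒳 Tate harmless). Mechanism gap: the motivic lift lands in H^{2p}_cdh = KH_0^{(p)}_ℚ but PB^p = ch_p(K_0 ⊗ ℚ); coker(K_0 → KH_0)_ℚ is ruled by cdh-descent failure of cyclic homology (CHSW), uncomputed for snc toric unions, ≠ 0 for cuspidal Y, p = 1 (BVS).
sources: Arapura2016SingularLefschetz, DeligneGoncharov2005, Borel1977, BarbieriVialeSrinivas1994NS, arXiv:math/0502255, arXiv:1301.0425
[crux] (card (G)/(M3) and E0 — the arithmetic-cusp theorem-candidate, typed.) For 𝒳, C, f, o as in X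
with X_o ℚ̄-Tate and ξ ∈ H^(2p)(𝒳(ℂ);ℂ) absolute Hodge, ξ|X_o lies in PB^p(X_o) := ℂ-span of {g^*a :
g : X_o → Y a ℂ-morphism, Y smooth projective, a ∈ algebraicClasses Y p} ( = ch_p(K₀(X_o) ⊗ ℚ) ⊗ ℂ:
every vector bundle is a Grassmannian pull-back after an ample twist, and conversely g^*cl(Z) =
ch_p(g^*u) with u = ch⁻¹[Z] ∈ K₀(Y)_ℚ by GRR, ch(u) concentrated in degree p; a rational class in
the ℂ-span of rational vectors lies in their ℚ-span). Intended proof: ξ|X_o ∈ Hom_MHS(ℚ(−p),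
H^(2p)(X_o)) (image of a pure weight-2p structure); X_o ≅ X₁ ⊗_σ ℂ with X₁ torus-partitioned over
ℚ̄, hence over a number field F, so M(X₁) ∈ DMT(F); Ext²_MT(F) = 0 gives H^(2p)_M(X₁, ℚ(p)) ↠
Hom_MT(F)(ℚ(−p), h^(2p)(X₁)); Gr^W_(2p)(ξ|X_o) is a ℚ-combination of cycle classes of strata,
canonically defined over F, and the Ext¹_MT-obstruction to lifting it into W_(2p) has vanishing
Hodge realisation at EVERY complex place τ = σ'σ because the conjugate ξ^σ' is again a Hodge class
restricting to X_o^σ' (absolute Hodge) — Borel injectivity on ⊕_τ for K_(2j−1)(F)_ℚ, j ≥ 2, units at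
j = 1, dévissage along the we -/
@[route_item "route-HodgeConjecture-MilnorFluxCusps"]
def ArithmeticTateRestriction : Prop :=
  ∀ (N p : ℕ) (𝒳 C : Literature.AlgebraicGeometry.Motives.SchemeOver ℂ) (f : 𝒳 ⟶ C) (o : Literature.AlgebraicGeometry.Motives.AlgPoints C ℂ), Literature.AlgebraicGeometry.Motives.IsSmoothProjective N 𝒳 → Literature.AlgebraicGeometry.Motives.IsSmoothProjective 1 C → (∃ (X₁ : Literature.AlgebraicGeometry.Motives.SchemeOver (AlgebraicClosure ℚ)) (σ : AlgebraicClosure ℚ →+* ℂ) (_ : Literature.AlgebraicGeometry.Motives.fiberOver f o ≅ (Literature.AlgebraicGeometry.Motives.baseChangeHom σ).obj X₁) (ι : Type) (_ : Finite ι) (b : ι → ℕ) (e : ∀ i : ι, Literature.AlgebraicGeometry.Motives.specOver (AlgebraicClosure ℚ) (AddMonoidAlgebra (AlgebraicClosure ℚ) (Fin (b i) →₀ ℤ)) ⟶ X₁), (∀ i, AlgebraicGeometry.IsImmersion (e i).left) ∧ (Pairwise fun i j => Disjoint (Set.range fun x => (e i).left.base x) (Set.range fun x => (e j).left.base x)) ∧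 (⋃ i, Set.range fun x => (e i).left.base x) = Set.univ) → ∀ ξ : Literature.AlgebraicGeometry.HodgeTheory.complexBetti 𝒳 (2 * p), Literature.AlgebraicGeometry.HodgeTheory.IsAbsoluteHodgeClass N 𝒳 p ξ → (Literature.AlgebraicGeometry.HodgeTheory.complexBetti.map (Literature.AlgebraicGeometry.Motives.fiberι f o) (2 * p)).hom ξ ∈ Submodule.span ℂ {c : Literature.AlgebraicGeometry.HodgeTheory.complexBetti (Literature.AlgebraicGeometry.Motives.fiberOver f o) (2 * p) | ∃ (m : ℕ) (Y : Literature.AlgebraicGeometry.Motives.SchemeOver ℂ) (_ : Literature.AlgebraicGeometry.Motives.IsSmoothProjective m Y) (g : Literature.AlgebraicGeometry.Motives.fiberOver f o ⟶ Y) (a : Literature.AlgebraicGeometry.HodgeTheory.complexBetti Y (2 * p)), a ∈ Literature.AlgebraicGeometry.HodgeTheory.algebraicClasses Y p ∧ c = (Literature.AlgebraicGeometry.HodgeTheory.complexBetti.map g (2 * p)).hom a}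

/-- item stmt-HodgeConjecture-7588 · crux · rank 3 · closed · moot by None · by planner
why it might fail: MISSTATED: f may be constant; o ∉ f(𝒳) gives X_o = ∅ (PB-hypothesis vacuous) and X_{f(𝒳)} ≅ 𝒳, so as typed it IS HC for every rational (p,p) class — restate with f surjective / X_o ≠ ∅. Intended content ⊇ variational HC over curves (open; BEK only formally); log-BEK on snc fibres unproved.
sources: BlochEsnaultKerz2014CharZero, Bloch1972Semiregularity, BuchweitzFlenner2003, arXiv:2604.00511, Steenbrink1976, CharlesSchnell2014Notes
[crux] (card E4, the sideways step; ANY fibre, no arithmetic.) For f : 𝒳 → C as above and ξ ∈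
H^(2p)(𝒳(ℂ);ℂ) rational of Hodge type (p,p): if ξ|X_o ∈ PB^p(X_o) — i.e. ξ|X_o = ch_p(v) for some v
∈ K₀(X_o) ⊗ ℚ with ch(v) concentrated in degree p — then ξ|X_t is algebraic on every smooth
projective fibre X_t. Mechanism: represent v by perfect complexes on X_o, deform over the formal/log
germ of C at o (log Bloch–Esnault–Kerz: the obstruction is the Hodge obstruction, which vanishes
because ξ is globally of type (p,p)), algebraize (𝒳 is projective over C), read off ch_p = ξ|X_t for
t near o, spread along C (countably many relative Chow components, one dominates). Contains
Grothendieck's variational Hodge conjecture over curves (support VariationalHodgeOverCurves = the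
case X_o smooth; KClassPropagates → it is proved in Sketch.lean). [deps: ArithmeticTateRestriction]
[difficulty: open-problem] -/
@[route_item "route-HodgeConjecture-MilnorFluxCusps"]
def KClassPropagates : Prop :=
  ∀ (N p : ℕ) (𝒳 C : Literature.AlgebraicGeometry.Motives.SchemeOver ℂ) (f : 𝒳 ⟶ C) (o : Literature.AlgebraicGeometry.Motives.AlgPoints C ℂ), Literature.AlgebraicGeometry.Motives.IsSmoothProjective N 𝒳 → Literature.AlgebraicGeometry.Motives.IsSmoothProjective 1 C → ∀ ξ : Literature.AlgebraicGeometry.HodgeTheory.complexBetti 𝒳 (2 * p), Literature.AlgebraicGeometry.HodgeTheory.IsRationalClass ξ → Literature.AlgebraicGeometry.HodgeTheory.IsOfHodgeType N 𝒳 (2 * p) p p ξ → (Literature.AlgebraicGeometry.HodgeTheory.complexBetti.map (Literature.AlgebraicGeometry.Motives.fiberι f o) (2 * p)).hom ξ ∈ Submodule.span ℂ {c : Literature.AlgebraicGeometry.HodgeTheory.complexBetti (Literature.AlgebraicGeometry.Motives.fiberOver f o) (2 * p) | ∃ (m : ℕ) (Y : Literature.AlgebraicGeometry.Motives.SchemeOver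 ℂ) (_ : Literature.AlgebraicGeometry.Motives.IsSmoothProjective m Y) (g : Literature.AlgebraicGeometry.Motives.fiberOver f o ⟶ Y) (a : Literature.AlgebraicGeometry.HodgeTheory.complexBetti Y (2 * p)), a ∈ Literature.AlgebraicGeometry.HodgeTheory.algebraicClasses Y p ∧ c = (Literature.AlgebraicGeometry.HodgeTheory.complexBetti.map g (2 * p)).hom a} → ∀ (t : Literature.AlgebraicGeometry.Motives.AlgPoints C ℂ) (n : ℕ), Literature.AlgebraicGeometry.Motives.IsSmoothProjective n (Literature.AlgebraicGeometry.Motives.fiberOver f t) → (Literature.AlgebraicGeometry.HodgeTheory.complexBetti.map (Literature.AlgebraicGeometry.Motives.fiberι f t) (2 * p)).hom ξ ∈ Literature.AlgebraicGeometry.HodgeTheory.algebraicClasses (Literature.AlgebraicGeometry.Motives.fiberOver f t) p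

/-- item stmt-HodgeConjecture-7589 · support · rank 9 · closed · moot by None · by planner
sources: BlochEsnaultKerz2014CharZero, Bloch1972Semiregularity, CharlesSchnell2014Notes
[support] the smooth-special-fibre case of KClassPropagates = Grothendieck's variational Hodge
conjecture in global-class form over a projective curve: ξ rational of type (p,p) on a smooth
projective 𝒳 → C, ξ|X_o algebraic on ONE smooth projective fibre X_o ⟹ ξ|X_t algebraic on every
smooth projective fibre. Filed to make the containment explicit (KClassPropagates →
VariationalHodgeOverCurves, three lines in Sketch.lean: an algebraic class on a smooth projective
fibre is a pulled-back algebraic class along the identity) and as the meeting point with route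
AnchorTransport's VariationalHodge (smooth families over an arbitrary smooth base, total space not
compactified). Open problem in general (known for p = 1 and in BEK's formal form). [difficulty:
open-problem] -/
@[route_item "route-HodgeConjecture-MilnorFluxCusps"]
def VariationalHodgeOverCurves : Prop :=
  ∀ (N p : ℕ) (𝒳 C : Literature.AlgebraicGeometry.Motives.SchemeOver ℂ) (f : 𝒳 ⟶ C) (o : Literature.AlgebraicGeometry.Motives.AlgPoints C ℂ), Literature.AlgebraicGeometry.Motives.IsSmoothProjective N 𝒳 → Literature.AlgebraicGeometry.Motives.IsSmoothProjective 1 C → ∀ ξ : Literature.AlgebraicGeometry.HodgeTheory.complexBetti 𝒳 (2 * p), Literature.AlgebraicGeometry.HodgeTheory.IsRationalClass ξ → Literature.AlgebraicGeometry.HodgeTheory.IsOfHodgeType N 𝒳 (2 * p) p p ξ → ∀ n₀ : ℕ, Literature.AlgebraicGeometry.Motives.IsSmoothProjective n₀ (Literature.AlgebraicGeometry.Motives.fiberOver f o) → (Literature.AlgebraicGeometry.HodgeTheory.complexBetti.map (Literature.AlgebraicGeometry.Motives.fiberι f o) (2 * p)).hom ξ ∈ Literature.AlgebraicGeometry.HodgeTheory.algebraicClasses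 (Literature.AlgebraicGeometry.Motives.fiberOver f o) p → ∀ (t : Literature.AlgebraicGeometry.Motives.AlgPoints C ℂ) (n : ℕ), Literature.AlgebraicGeometry.Motives.IsSmoothProjective n (Literature.AlgebraicGeometry.Motives.fiberOver f t) → (Literature.AlgebraicGeometry.HodgeTheory.complexBetti.map (Literature.AlgebraicGeometry.Motives.fiberι f t) (2 * p)).hom ξ ∈ Literature.AlgebraicGeometry.HodgeTheory.algebraicClasses (Literature.AlgebraicGeometry.Motives.fiberOver f t) p

/-- item stmt-HodgeConjecture-7590 · assembly · rank 1 · closed · moot by None · by planner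
sources: Arapura2016SingularLefschetz, BlochEsnaultKerz2014CharZero
[assembly] ArithmeticTateRestriction → KClassPropagates → CuspAccessibleHodge (pure logic; proved in
Sketch.lean). -/
@[route_item "route-HodgeConjecture-MilnorFluxCusps"]
def Assembly : Prop :=
  ArithmeticTateRestriction → KClassPropagates → CuspAccessibleHodge

end Summit.HodgeConjecture.HodgeConjecture.Theses.MilnorFluxCusps
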